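import Literature.Geometry.Kaehler.RiemannSurfaceChevalleyWeilLinearCharacters
import Mathlib.Data.ZMod.Units
import Mathlib.FieldTheory.Finite.Basic
import HarnessLib

/-!
# The part of `𝓗¹(M)` belonging to a cyclic quotient `Q = G/N`:
# `Σ_{χ ∈ Ĝ, ker χ = N} dim E_χ = φ(|Q|)·(g_S − 1 + δ) + ½ φ(|Q|)·#{branch values q : G_q ⊄ N}`
# (Kopeliovich–Zemel, Theorem 7.3 — the dimension of `B_Q`)

Layer `Literature/Geometry/Kaehler`, sequel of `RiemannSurfaceChevalleyWeilLinearCharacters` (for a linear character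
`χ` of `G ≤ Aut M`: the eigenspace `E_χ = {φ ∈ 𝓗¹(M) : hφ = χ(h)φ} = ⋂_h Eig(h|𝓗¹(M), χ(h))` has
`dim E_{χ⁻¹} + dim E_χ = 2[χ = 1] + 2(γ − 1) + #{q : χ(G_q) ≠ 1}`, Kopeliovich–Zemel Proposition 7.1 «for
characters»). S. Kopeliovich, S. Zemel, Israel J. Math. 234 (2019), as printed (arXiv:1609.02296 p. 32):

> **Theorem 7.3.** Let `Q = G/N` be a cyclic quotient of `G`. Then one associates with `Q` a canonical subvariety of
> `J(X)`, which we denote by `B_Q`, whose dimension equals `φ(|Q|)[g_S − 1 + δ + Σ_{C ⊄ N} r_C/2]`, where `δ` is `1`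
> if `N = G` (i.e., if `Q` is trivial) and `0` otherwise. The map `∏_Q B_Q → J(X)`, where the product is taken over
> all the cyclic quotients of `G`, has finite kernel […]. In case `G` is Abelian, this map is surjective, and yields
> a decomposition of `J(X)` up to isogeny.
> *Proof.* As characters of `G` map `G` onto finite (hence cyclic) subgroups of `S¹`, each such character becomes a
> faithful character of a cyclic quotient `Q = G/N` of `G`. Moreover, if `χ ∈ Ĝ` is an embedding of `Q` into `S¹`
> then the other elements of `Ĝ` that are embeddings of the same quotient `Q` are precisely the images of `χ` under
> the Galois group `Γ_χ` […] for such a representation `W` we have `k_W = φ(|Q|)` […]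

THE FORM PROVED HERE (the tangent space `T₀B_Q ⊆ T₀J(X) = 𝓗¹(M)^*`, i.e. the statement about `Ω(1) = 𝓗¹(M)`).
A cyclic quotient `Q = G/N` of order `n` is the same as a linear character `χ : G → ℂˣ` with `ker χ = N` up to the
choice of the embedding `Q ↪ S¹`; the characters with kernel exactly `N` — the faithful characters of `Q`, the
Galois conjugates of `χ` — are the powers `χᵏ`, `k ∈ (ℤ/nℤ)ˣ`, `n = |Q| =` the order of `χ` in `Ĝ`
(`ker_pow_eq_ker`, `pow_val_injective`). The `W`-part of `ρ_a` is `⊕_{k ∈ (ℤ/nℤ)ˣ} E_{χᵏ}`, and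

  `Σ_{k ∈ (ℤ/nℤ)ˣ} dim E_{χᵏ} = φ(n)·(γ − 1 + δ) + ½ φ(n)·#{branch values q : χ(G_q) ≠ 1}`

(`sum_units_finrank_iInf_eigenspace_pow_eq`; `δ = [χ = 1]`, and `χ(G_q) ≠ 1 ⟺ G_q ⊄ N`, each of the `r_C` branch
values of a class `C ⊄ N` counted once). The proof pairs `k` with `−k`: `E_{χ^{−k}} = E_{(χᵏ)⁻¹}`, and Proposition 7.1
gives `dim E_{(χᵏ)⁻¹} + dim E_{χᵏ} = 2δ + 2(γ − 1) + #{q : χᵏ(G_q) ≠ 1} = 2δ + 2(γ − 1) + #{q : χ(G_q) ≠ 1}` for every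
unit `k`. (The subvariety `B_Q` itself, the finite kernel and the isogeny for Abelian `G` are statements about the
Jacobian and are not formalised here.)

## What is proved (no definitions, no named facts, no instances)

* §1 (linear characters `χ : G →* ℂˣ` of a finite group): `isOfFinOrder_char`, `pow_orderOf_apply`,
  `pow_apply_eq_one_iff_of_coprime` (`χᵏ(h) = 1 ⟺ χ(h) = 1` for `k` prime to the order), `ker_pow_eq_ker`,
  `pow_eq_one_iff_of_coprime`, `pow_val_neg_eq_inv` (`χ^{(−k)} = (χᵏ)⁻¹` on `(ℤ/nℤ)ˣ`), `val_coe_coprime_orderOf`,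
  `pow_val_injective` (the `χᵏ`, `k ∈ ℤ/nℤ`, are pairwise distinct), `card_units_zmod_eq_totient` (`|(ℤ/nℤ)ˣ| = φ(n)`);
* §2 for `G ≤ Aut M`: `finrank_iInf_eigenspace_char_inv_add_eq` (Proposition 7.1 for `χ : G →* ℂˣ`:
  `dim E_{χ⁻¹} + dim E_χ = 2[χ = 1] + 2(γ − 1) + #{q : χ(G_q) ≠ 1}`), **`two_mul_sum_units_finrank_iInf_eigenspace_pow_eq`**
  and **`sum_units_finrank_iInf_eigenspace_pow_eq`** (THEOREM 7.3's dimension: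
  `Σ_{k ∈ (ℤ/nℤ)ˣ} dim E_{χᵏ} = φ(n)(γ − 1 + [χ = 1]) + ½ φ(n)·#{q : χ(G_q) ≠ 1}`), `finrank_iInf_eigenspace_one_char`
  (`χ = 1`: the part is `𝓗¹(M)^G`, of dimension `γ`).

## References

* S. Kopeliovich, S. Zemel, *On spaces associated with invariant divisors on Galois covers of Riemann surfaces and
  their applications*, Israel J. Math. 234 (2019), Theorem 7.3 (with proof), Proposition 7.1, Corollary 7.4
  (arXiv:1609.02296 pp. 30–32). [KopeliovichZemel2019]
* H. Lange, R. E. Rodríguez, *Decomposition of Jacobians by Prym varieties*, LNM 2310 (2022), §3.5.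
  [LangeRodriguez2022]
-/

noncomputable section

open scoped Manifold ContDiff Topology
open Set Filter Function Complex MulAction Module

namespace Literature.Geometry.Kaehler

namespace RiemannSurface

/-! ### §1 Linear characters of a finite group: powers prime to the order -/

section Characters

variable {G : Type*} [Group G] [Finite G] (χ : G →* ℂˣ)

/-- A linear character of a finite group has finite order in `Ĝ` (`χ^{|G|} = 1`).
[cite: KopeliovichZemel2019, Theorem 7.3 (proof: «characters of `G` map `G` onto finite (hence cyclic) subgroups of `S¹`»)] -/
theorem isOfFinOrder_char : IsOfFinOrder χ := by
  refine isOfFinOrder_iff_pow_eq_one.2 ⟨Nat.card G, Nat.card_pos, MonoidHom.ext fun h ↦ ?_⟩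
  rw [MonoidHom.pow_apply, ← map_pow, pow_card_eq_one', map_one, MonoidHom.one_apply]

omit [Finite G] in
/-- `χ(h)^n = 1` for `n` the order of `χ`. [cite: KopeliovichZemel2019, Theorem 7.3 (proof)] -/
theorem pow_orderOf_apply (h : G) : χ h ^ orderOf χ = 1 := by
  rw [← MonoidHom.pow_apply, pow_orderOf_eq_one, MonoidHom.one_apply]

/-- The order of a linear character is positive. [cite: KopeliovichZemel2019, Theorem 7.3 (proof)] -/
theorem orderOf_char_pos : 0 < orderOf χ := (isOfFinOrder_char χ).orderOf_pos

omit [Finite G] in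
/-- **For `k` prime to the order `n` of `χ`: `χᵏ(h) = 1 ⟺ χ(h) = 1`** (the order of `χ(h)` divides `n` and `k`).
[cite: KopeliovichZemel2019, Theorem 7.3 (proof: «the other elements of `Ĝ` that are embeddings of the same quotient
`Q` are precisely the images of `χ` under the Galois group»)] -/
theorem pow_apply_eq_one_iff_of_coprime {k : ℕ} (hk : k.Coprime (orderOf χ)) (h : G) :
    (χ ^ k) h = 1 ↔ χ h = 1 := by
  rw [MonoidHom.pow_apply]
  refine ⟨fun h1 ↦ ?_, fun h1 ↦ by rw [h1, one_pow]⟩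
  have hd1 : orderOf (χ h) ∣ k := orderOf_dvd_of_pow_eq_one h1
  have hd2 : orderOf (χ h) ∣ orderOf χ := orderOf_dvd_of_pow_eq_one (pow_orderOf_apply χ h)
  have hd : orderOf (χ h) ∣ 1 := by
    rw [← Nat.Coprime.gcd_eq_one hk]
    exact Nat.dvd_gcd hd1 hd2
  exact orderOf_eq_one_iff.1 (Nat.dvd_one.1 hd)

omit [Finite G] in
/-- **`ker χᵏ = ker χ` for `k` prime to the order of `χ`**: the powers `χᵏ`, `k ∈ (ℤ/nℤ)ˣ`, are characters of the same
cyclic quotient `Q = G/ker χ`, faithful on `Q`. [cite: KopeliovichZemel2019, Theorem 7.3 (proof)] -/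
theorem ker_pow_eq_ker {k : ℕ} (hk : k.Coprime (orderOf χ)) : (χ ^ k).ker = χ.ker := by
  ext h
  rw [MonoidHom.mem_ker, MonoidHom.mem_ker, pow_apply_eq_one_iff_of_coprime χ hk]

omit [Finite G] in
/-- `χᵏ = 1 ⟺ χ = 1` for `k` prime to the order. [cite: KopeliovichZemel2019, Theorem 7.3 (proof)] -/
theorem pow_eq_one_iff_of_coprime {k : ℕ} (hk : k.Coprime (orderOf χ)) : χ ^ k = 1 ↔ χ = 1 := by
  simp only [MonoidHom.ext_iff, MonoidHom.one_apply]
  exact forall_congr' fun h ↦ pow_apply_eq_one_iff_of_coprime χ hk h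

variable {n : ℕ} [NeZero n]

omit [Finite G] in
/-- On `(ℤ/nℤ)ˣ`, `n` the order of `χ`: **`χ^{(−k)} = (χᵏ)⁻¹`** (exponents read through `ZMod.val`).
[cite: KopeliovichZemel2019, Theorem 7.3 (proof)] -/
theorem pow_val_neg_eq_inv (hn : orderOf χ = n) (k : (ZMod n)ˣ) :
    χ ^ ((-k : (ZMod n)ˣ) : ZMod n).val = (χ ^ (k : ZMod n).val)⁻¹ := by
  have h0 : (((-k : (ZMod n)ˣ) : ZMod n) + (k : ZMod n)) = 0 := by
    rw [Units.val_neg, neg_add_cancel]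
  have h1 := congrArg ZMod.val h0
  rw [ZMod.val_add, ZMod.val_zero] at h1
  have hdvd : orderOf χ ∣ ((-k : (ZMod n)ˣ) : ZMod n).val + (k : ZMod n).val := by
    rw [hn]
    exact Nat.dvd_of_mod_eq_zero h1
  -- pointwise in the commutative group `ℂˣ`
  refine MonoidHom.ext fun h ↦ ?_
  rw [MonoidHom.pow_apply, MonoidHom.inv_apply, MonoidHom.pow_apply]
  refine eq_inv_of_mul_eq_one_left ?_
  rw [← pow_add, ← orderOf_dvd_iff_pow_eq_one]
  exact (orderOf_dvd_of_pow_eq_one (pow_orderOf_apply χ h)).trans hdvd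

omit [Finite G] [NeZero n] in
/-- The exponent of a unit of `ℤ/nℤ` is prime to `n`, the order of `χ`. [cite: KopeliovichZemel2019, Theorem 7.3 (proof)] -/
theorem val_coe_coprime_orderOf (hn : orderOf χ = n) (k : (ZMod n)ˣ) : ((k : ZMod n).val).Coprime (orderOf χ) := by
  rw [hn]
  exact ZMod.val_coe_unit_coprime k

omit [Finite G] in
/-- The characters `χᵏ`, `k ∈ ℤ/nℤ` (`n` the order of `χ`), are pairwise distinct.
[cite: KopeliovichZemel2019, Theorem 7.3 (proof)] -/
theorem pow_val_injective (hn : orderOf χ = n) : Injective fun k : ZMod n ↦ χ ^ k.val := by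
  intro a b hab
  have ha : a.val < orderOf χ := hn ▸ ZMod.val_lt a
  have hb : b.val < orderOf χ := hn ▸ ZMod.val_lt b
  exact ZMod.val_injective _ (pow_injOn_Iio_orderOf (x := χ) ha hb hab)

omit [NeZero n] in
/-- `|(ℤ/nℤ)ˣ| = φ(n)` («`k_W = φ(|Q|)`»). [cite: KopeliovichZemel2019, Theorem 7.3 (proof)] -/
theorem card_units_zmod_eq_totient (n : ℕ) [NeZero n] [Fintype (ZMod n)ˣ] : Fintype.card (ZMod n)ˣ = n.totient :=
  ZMod.card_units_eq_totient n

end Characters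

/-! ### §2 The part of `𝓗¹(M)` of a cyclic quotient -/

section OneForms

variable {M : Type*} [TopologicalSpace M] [ChartedSpace ℂ M] [IsManifold 𝓘(ℂ, ℂ) ω M]
  [CompactSpace M] [T2Space M] [PreconnectedSpace M] [Nonempty M] [Finite (autGroup M)]
  (G : Subgroup (autGroup M)) (χ : ↥G →* ℂˣ)

open OrbitSurface

open Classical in
/-- **Proposition 7.1 for a linear character `χ : G → ℂˣ`**:
`dim E_{χ⁻¹} + dim E_χ = 2[χ = 1] + 2(γ − 1) + #{branch values q : χ(G_q) ≠ 1}`, `E_χ = ⋂_h Eig(h|𝓗¹(M), χ(h))`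
(the one-dimensional representation `h ↦ χ(h)·1` on `ℂ` has character `χ`). [cite: KopeliovichZemel2019, Proposition 7.1] -/
theorem finrank_iInf_eigenspace_char_inv_add_eq [Fintype ↥G] :
    (finrank ℂ ↥(⨅ h : ↥G, Module.End.eigenspace (oneFormRep M (h : autGroup M)) ((χ h : ℂ)⁻¹)) : ℂ) +
        finrank ℂ ↥(⨅ h : ↥G, Module.End.eigenspace (oneFormRep M (h : autGroup M)) (χ h : ℂ)) =
      2 * (if χ = 1 then 1 else 0 : ℂ) + 2 * ((arithGenus (OrbitSurface G M) : ℂ) - 1) +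
      (((branchDiv (mk G : M → OrbitSurface G M)).support.filter fun q : OrbitSurface G M ↦
        ∃ h ∈ stabilizer (↥G) q.out, χ h ≠ 1).card : ℂ) := by
  -- the one-dimensional representation of `χ` on `ℂ`
  let ρ : Representation ℂ ↥G ℂ := (DistribMulAction.toModuleEnd ℂ ℂ : ℂˣ →* Module.End ℂ ℂ).comp χ
  have hρ : ∀ h : ↥G, ρ h = ((χ h : ℂˣ) : ℂ) • (LinearMap.id : ℂ →ₗ[ℂ] ℂ) := fun h ↦ by
    refine LinearMap.ext fun z ↦ ?_
    simp [ρ, Units.smul_def]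
  have htr : ∀ h : ↥G, LinearMap.trace ℂ ℂ (ρ h) = (χ h : ℂ) := fun h ↦ by
    rw [hρ, map_smul, LinearMap.trace_id, Module.finrank_self, Nat.cast_one, smul_eq_mul, mul_one]
  have hV : finrank ℂ ℂ = 1 := Module.finrank_self ℂ
  have h := finrank_iInf_eigenspace_inv_add_eq G ρ hV
  have hI₁ : (⨅ h : ↥G, Module.End.eigenspace (oneFormRep M (h : autGroup M)) (LinearMap.trace ℂ ℂ (ρ h))⁻¹) =
      ⨅ h : ↥G, Module.End.eigenspace (oneFormRep M (h : autGroup M)) ((χ h : ℂ)⁻¹) :=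
    iInf_congr fun h ↦ by rw [htr]
  have hI₂ : (⨅ h : ↥G, Module.End.eigenspace (oneFormRep M (h : autGroup M)) (LinearMap.trace ℂ ℂ (ρ h))) =
      ⨅ h : ↥G, Module.End.eigenspace (oneFormRep M (h : autGroup M)) (χ h : ℂ) :=
    iInf_congr fun h ↦ by rw [htr]
  have hfilter : ((branchDiv (mk G : M → OrbitSurface G M)).support.filter fun q : OrbitSurface G M ↦
      ∃ h ∈ stabilizer (↥G) q.out, LinearMap.trace ℂ ℂ (ρ h) ≠ 1) =
      (branchDiv (mk G : M → OrbitSurface G M)).support.filter fun q : OrbitSurface G M ↦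
        ∃ h ∈ stabilizer (↥G) q.out, χ h ≠ 1 := by
    refine Finset.filter_congr fun q _ ↦ ?_
    simp only [htr, ne_eq, Units.val_eq_one]
  rw [hI₁, hI₂, hfilter, finrank_invariants_eq_ite_of_finrank_eq_one ρ hV] at h
  have hcond : (∀ g : ↥G, LinearMap.trace ℂ ℂ (ρ g) = 1) ↔ χ = 1 := by
    simp only [htr, MonoidHom.ext_iff, MonoidHom.one_apply, Units.val_eq_one]
  by_cases hχ : χ = 1
  · rw [if_pos (hcond.2 hχ), Nat.cast_one] at h
    rw [if_pos hχ]
    exact h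
  · rw [if_neg (mt hcond.1 hχ), Nat.cast_zero] at h
    rw [if_neg hχ]
    exact h

/-- The trivial character: `E_1 = 𝓗¹(M)^G` has dimension `γ` (the part of the trivial quotient `G/G`, «the Jacobian
`J(S)` appears, via `f^*`, as the subvariety … associated with the trivial quotient»).
[cite: KopeliovichZemel2019, Theorem 7.3, Proposition 7.1] -/
theorem finrank_iInf_eigenspace_one_char [Fintype ↥G] :
    finrank ℂ ↥(⨅ h : ↥G, Module.End.eigenspace (oneFormRep M (h : autGroup M)) (((1 : ↥G →* ℂˣ) h : ℂˣ) : ℂ)) =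
      arithGenus (OrbitSurface G M) := by
  simp only [MonoidHom.one_apply, Units.val_one]
  exact finrank_iInf_eigenspace_one_oneFormRep_eq G

variable {n : ℕ} [NeZero n]

open Classical in
/-- **THEOREM 7.3 (dimension of `B_Q`), doubled form**: for a linear character `χ` of `G ≤ Aut M` of order `n`
(`Q = G/ker χ` cyclic of order `n`),
`2 Σ_{k ∈ (ℤ/nℤ)ˣ} dim E_{χᵏ} = φ(n)·(2[χ = 1] + 2(γ − 1) + #{branch values q : χ(G_q) ≠ 1})` — the sum over the
faithful characters `χᵏ` of `Q`, paired by `k ↦ −k`. [cite: KopeliovichZemel2019, Theorem 7.3] -/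
theorem two_mul_sum_units_finrank_iInf_eigenspace_pow_eq [Fintype ↥G] (hn : orderOf χ = n) :
    2 * ∑ k : (ZMod n)ˣ, (finrank ℂ ↥(⨅ h : ↥G, Module.End.eigenspace (oneFormRep M (h : autGroup M))
        ((χ ^ (k : ZMod n).val) h : ℂ)) : ℂ) =
      n.totient * (2 * (if χ = 1 then 1 else 0 : ℂ) + 2 * ((arithGenus (OrbitSurface G M) : ℂ) - 1) +
        (((branchDiv (mk G : M → OrbitSurface G M)).support.filter fun q : OrbitSurface G M ↦
          ∃ h ∈ stabilizer (↥G) q.out, χ h ≠ 1).card : ℂ)) := by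
  -- pair `k` with `−k`
  have hsum : 2 * ∑ k : (ZMod n)ˣ, (finrank ℂ ↥(⨅ h : ↥G, Module.End.eigenspace (oneFormRep M (h : autGroup M))
        ((χ ^ (k : ZMod n).val) h : ℂ)) : ℂ) =
      ∑ k : (ZMod n)ˣ, ((finrank ℂ ↥(⨅ h : ↥G, Module.End.eigenspace (oneFormRep M (h : autGroup M))
        (((χ ^ (k : ZMod n).val) h : ℂ)⁻¹)) : ℂ) +
        finrank ℂ ↥(⨅ h : ↥G, Module.End.eigenspace (oneFormRep M (h : autGroup M)) ((χ ^ (k : ZMod n).val) h : ℂ))) := by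
    rw [two_mul, Finset.sum_add_distrib]
    congr 1
    rw [← Equiv.sum_comp (Equiv.neg (ZMod n)ˣ)]
    refine Finset.sum_congr rfl fun k _ ↦ ?_
    rw [Equiv.neg_apply, pow_val_neg_eq_inv χ hn]
    have hI : (⨅ h : ↥G, Module.End.eigenspace (oneFormRep M (h : autGroup M))
        (((χ ^ (k : ZMod n).val)⁻¹ h : ℂˣ) : ℂ)) =
        ⨅ h : ↥G, Module.End.eigenspace (oneFormRep M (h : autGroup M)) (((χ ^ (k : ZMod n).val) h : ℂ)⁻¹) :=
      iInf_congr fun h ↦ by rw [MonoidHom.inv_apply, Units.val_inv_eq_inv_val]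
    rw [hI]
  rw [hsum]
  -- each pair contributes the same amount (Proposition 7.1 for `χᵏ`, whose kernel is `ker χ`)
  have hterm : ∀ k : (ZMod n)ˣ, ((finrank ℂ ↥(⨅ h : ↥G, Module.End.eigenspace (oneFormRep M (h : autGroup M))
        (((χ ^ (k : ZMod n).val) h : ℂ)⁻¹)) : ℂ) +
        finrank ℂ ↥(⨅ h : ↥G, Module.End.eigenspace (oneFormRep M (h : autGroup M)) ((χ ^ (k : ZMod n).val) h : ℂ))) =
      2 * (if χ = 1 then 1 else 0 : ℂ) + 2 * ((arithGenus (OrbitSurface G M) : ℂ) - 1) +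
        (((branchDiv (mk G : M → OrbitSurface G M)).support.filter fun q : OrbitSurface G M ↦
          ∃ h ∈ stabilizer (↥G) q.out, χ h ≠ 1).card : ℂ) := by
    intro k
    have hk := val_coe_coprime_orderOf χ hn k
    rw [finrank_iInf_eigenspace_char_inv_add_eq G (χ ^ (k : ZMod n).val), pow_eq_one_iff_of_coprime χ hk]
    congr 3
    refine Finset.filter_congr fun q _ ↦ ?_
    simp only [ne_eq, pow_apply_eq_one_iff_of_coprime χ hk]
  rw [Finset.sum_congr rfl fun k _ ↦ hterm k, Finset.sum_const, Finset.card_univ, ZMod.card_units_eq_totient n,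
    nsmul_eq_mul]

open Classical in
/-- **THEOREM 7.3 (Kopeliovich–Zemel): the dimension of the part of `𝓗¹(M)` belonging to the cyclic quotient
`Q = G/ker χ`** — `Σ_{k ∈ (ℤ/nℤ)ˣ} dim E_{χᵏ} = φ(n)·(γ − 1 + [χ = 1]) + ½ φ(n)·#{branch values q : χ(G_q) ≠ 1}`,
`n = |Q|` the order of `χ` («`dim B_Q = φ(|Q|)[g_S − 1 + δ + Σ_{C ⊄ N} r_C/2]`»). [cite: KopeliovichZemel2019, Theorem 7.3] -/
theorem sum_units_finrank_iInf_eigenspace_pow_eq [Fintype ↥G] (hn : orderOf χ = n) :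
    ∑ k : (ZMod n)ˣ, (finrank ℂ ↥(⨅ h : ↥G, Module.End.eigenspace (oneFormRep M (h : autGroup M))
        ((χ ^ (k : ZMod n).val) h : ℂ)) : ℂ) =
      n.totient * (((arithGenus (OrbitSurface G M) : ℂ) - 1) + (if χ = 1 then 1 else 0 : ℂ)) +
        n.totient / 2 *
          (((branchDiv (mk G : M → OrbitSurface G M)).support.filter fun q : OrbitSurface G M ↦
            ∃ h ∈ stabilizer (↥G) q.out, χ h ≠ 1).card : ℂ) := by
  have h := two_mul_sum_units_finrank_iInf_eigenspace_pow_eq G χ hn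
  have h2 : (2 : ℂ) ≠ 0 := two_ne_zero
  have h' : ∑ k : (ZMod n)ˣ, (finrank ℂ ↥(⨅ h : ↥G, Module.End.eigenspace (oneFormRep M (h : autGroup M))
        ((χ ^ (k : ZMod n).val) h : ℂ)) : ℂ) =
      (n.totient * (2 * (if χ = 1 then 1 else 0 : ℂ) + 2 * ((arithGenus (OrbitSurface G M) : ℂ) - 1) +
        (((branchDiv (mk G : M → OrbitSurface G M)).support.filter fun q : OrbitSurface G M ↦
          ∃ h ∈ stabilizer (↥G) q.out, χ h ≠ 1).card : ℂ))) / 2 := by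
    rw [← h, mul_div_cancel_left₀ _ h2]
  rw [h']
  ring

end OneForms

end RiemannSurface

end Literature.Geometry.Kaehler
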